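import Literature.AlgebraicTopology.CharacteristicClasses.ChernClassModTwoReduction
import Literature.AlgebraicTopology.SingularHomology.SphereLikeRingChange
import HarnessLib

/-!
# The Grothendieck Chern classes are natural in the coefficient ring

D. Husemoller, *Fibre Bundles* (3rd ed. 1994), Ch. 17 §2 Def. 2.6 defines the Chern classes of a
complex vector bundle with coefficients in ANY commutative ring `R` through the relation
`aⁿ = -Σ cᵢ(ξ) aⁿ⁻ⁱ` in `H^*(P(ξ); R)`; §3 and Ch. 20 §4 ("we denote by `c₁(ξ)` the image under
`H²(X, ℤ) → H²(X, R)` of the first Chern class") use that the construction is natural in the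
coefficient ring: for a ring homomorphism `φ : R → S`, **`cᵢ(ξ)_S = φ_* cᵢ(ξ)_R`**. J. Milnor,
J. Stasheff, *Characteristic Classes* (1974), §14 Problem 14-B is the case `ℤ → ℤ/2`, already in the
tree (`ChernClassModTwoReduction.lean`, where the only coefficient-specific input was a parity
argument for the generator `ω(1) ∈ H²(ℂP¹)`). With `IsSphereLike.ringChange_omegaFibre`
(`SingularHomology/SphereLikeRingChange.lean`: `φ_* ω(m) = ω(φ m)` for every `φ`) the same chain of
uniqueness statements gives the general case:

* `omegaModel_ringChange`, `omegaStd_ringChange`, `omegaFib_ringChange` — the fibre generators;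
* `isThomClass_ringChange`, `thomClass_ringChange`, `eulerClass_ringChange` — the Thom class
  `t(m)` and the Euler class of a complex line bundle (uniqueness of Thom classes);
* `ComplexVectorBundle.lineEuler_ringChange`, `xClass_ringChange` — the class `x = e(λ)` on `P(E)`;
* **`ComplexVectorBundle.chernClassR_ringChange`: `cᵢ(E)_S = φ_* cᵢ(E)_R`** (uniqueness of Chern
  families, `IsChernFamily.ringChange`); `chernClassZ_ringChange` and
  `theChernClassTheory_chernClassIn` — the tree's classes "with coefficients in `R`"
  (`ChernClassTheory.chernClassIn R`, images of the integral classes) ARE the Grothendieck classes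
  `chernClassR R` over paracompact Hausdorff bases.

Everything is proved; no named facts. Written for the comparison of the Betti Chern classes of
algebraic vector bundles with `ℤ`, `ℚ` and `ℂ` coefficients (Hodge conjecture tree, item 19780).

## References

* D. Husemoller, *Fibre Bundles*, 3rd ed., GTM 20, Springer 1994, Ch. 17 §2 Def. 2.6, §3; Ch. 20 §4.
  [HusemollerFibreBundles1994]
* J. Milnor, J. Stasheff, *Characteristic Classes*, Ann. of Math. Stud. 76, PUP 1974, §10 Thm. 10.4,
  §14 Problem 14-B. [MilnorStasheff1974]
* A. Hatcher, *Algebraic Topology*, CUP 2002, §3.1 p. 198 (change of coefficients). [HatcherAT2002]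
-/

noncomputable section

open CategoryTheory Function Set Bundle Literature.AlgebraicTopology.SingularHomology
open scoped LinearAlgebra.Projectivization

namespace Literature.AlgebraicTopology.CharacteristicClasses

variable {R S : Type} [CommRing R] [CommRing S] (φ : R →+* S)

/-! ### The fibre generator `ω(m)` -/

section Model

variable (F : Type) [NormedAddCommGroup F] [NormedSpace ℂ F] (hF : Module.finrank ℂ F = 1)

/-- **`φ_* ω(m) = ω(φ m)` in `H²(ℙ(F ⊕ ℂ); S)`** (the generator of the model sphere-like space is
natural in the coefficients). [cite: HatcherAT2002, §3.1 p. 198] -/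
theorem omegaModel_ringChange (m : R) :
    singularCohomology.ringChange φ (ℙ ℂ (F × ℂ)) 2 (omegaModel F hF R R m) = omegaModel F hF S S (φ m) :=
  (modelSphereLike F hF).ringChange_omegaFibre φ m

/-- The same for the fixed model line `ULift ℂ`. [cite: HatcherAT2002, §3.1 p. 198] -/
theorem omegaStd_ringChange (m : R) :
    singularCohomology.ringChange φ (ℙ ℂ (ULift.{0} ℂ × ℂ)) 2 (omegaStd R R m) = omegaStd S S (φ m) :=
  omegaModel_ringChange φ (ULift.{0} ℂ) finrank_model m

end Model

/-! ### Line bundles: the Thom class and the Euler class -/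

section Line

variable {B : Type} [TopologicalSpace B] (F : Type) [NormedAddCommGroup F] [NormedSpace ℂ F] [FiniteDimensional ℂ F]
  (E : B → Type) [∀ b, AddCommGroup (E b)] [∀ b, Module ℂ (E b)]
  [TopologicalSpace (TotalSpace F E)] [∀ b, TopologicalSpace (E b)] [FiberBundle F E] [VectorBundle ℂ F E]
  (hF : Module.finrank ℂ F = 1)

omit [FiniteDimensional ℂ F] in
/-- **`φ_* ω_b(m) = ω_b(φ m)`**: the fibre generators are natural in the coefficients.
[cite: HatcherAT2002, §3.1 p. 198] -/
theorem omegaFib_ringChange (b : B) (m : R) :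
    singularCohomology.ringChange φ (ℙ ℂ (E b × ℂ)) 2 (omegaFib F E hF R R b m) = omegaFib F E hF S S b (φ m) := by
  rw [omegaFib, omegaFib, ringChange_map, omegaStd_ringChange]

variable [T2Space B] [ParacompactSpace B]

/-- **`φ_* t(m)` is a Thom class with generator `φ m`** (both defining conditions are natural in the
coefficients). [cite: MilnorStasheff1974, §10 Thm. 10.4] -/
theorem isThomClass_ringChange (m : R) :
    IsThomClass F E hF S (φ m) (singularCohomology.ringChange φ (ProjCompl F E) 2 (thomClass F E hF R m)) where
  map_complInf := by
    rw [← ringChange_map, (isThomClass_thomClass F E hF R m).map_complInf, map_zero]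
  map_complFibreIncl b := by
    rw [← ringChange_map, (isThomClass_thomClass F E hF R m).map_complFibreIncl b, omegaFib_ringChange]

/-- **`t(φ m) = φ_* t(m)`** for the Thom classes of a complex line bundle (uniqueness of Thom classes).
[cite: MilnorStasheff1974, §10 Thm. 10.4] -/
theorem thomClass_ringChange (m : R) :
    thomClass F E hF S (φ m) = singularCohomology.ringChange φ (ProjCompl F E) 2 (thomClass F E hF R m) :=
  (isThomClass_ringChange φ F E hF m).eq_thomClass.symm

/-- **`e(φ m) = φ_* e(m)`** for the Euler classes of a complex line bundle; with `m = 1`: the first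
Chern class with `S`-coefficients is the image of the one with `R`-coefficients.
[cite: HusemollerFibreBundles1994, Ch. 20 §4] -/
theorem eulerClass_ringChange (m : R) :
    eulerClass F E hF S (φ m) = singularCohomology.ringChange φ B 2 (eulerClass F E hF R m) := by
  rw [eulerClass, eulerClass, thomClass_ringChange φ, ringChange_map]

end Line

/-! ### Complex vector bundles: `x`, the Chern classes -/

namespace ComplexVectorBundle

variable {B : Type} [TopologicalSpace B] [T2Space B] [ParacompactSpace B] (E : ComplexVectorBundle.{0, 0} B)

/-- `e_S(φ m) = φ_* e_R(m)` for the Euler class of the tautological line bundle of `P(E)` in any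
coordinate. [cite: HusemollerFibreBundles1994, Ch. 17 §2] -/
theorem lineEuler_ringChange (k₀ : Fin E.rank) (m : R) :
    E.lineEuler k₀ S (φ m) = singularCohomology.ringChange φ E.Proj 2 (E.lineEuler k₀ R m) :=
  eulerClass_ringChange φ _ _ _ m

/-- **`x_S = φ_* x_R ∈ H²(P(E); S)`.** [cite: HusemollerFibreBundles1994, Ch. 17 §2] -/
theorem xClass_ringChange (hE : 0 < E.rank) :
    E.xClass S hE = singularCohomology.ringChange φ E.Proj 2 (E.xClass R hE) := by
  have h := E.lineEuler_ringChange φ (E.k0 hE) 1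
  rw [map_one] at h
  exact h

/-- **`cᵢ(E)_S = φ_* cᵢ(E)_R`: the Grothendieck Chern classes are natural in the coefficient ring**
(Husemoller Ch. 17 §3 / Ch. 20 §4): the images `φ_* cᵢ(E)_R` form a Chern family for
`(q, x_S, n)` (`IsChernFamily.ringChange`, `xClass_ringChange`), and Chern families are unique
(Def. 2.6, Thm. 2.5). [cite: HusemollerFibreBundles1994, Ch. 17 Def. 2.6, Thm. 2.5 and Ch. 20 §4] -/
theorem chernClassR_ringChange (i : ℕ) :
    E.chernClassR S i = singularCohomology.ringChange φ B (2 * i) (E.chernClassR R i) := by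
  rcases Nat.eq_zero_or_pos E.rank with h0 | hE
  · rcases Nat.eq_zero_or_pos i with rfl | hi
    · rw [E.chernClassR_zero, E.chernClassR_zero, ringChange_one]
    · rw [E.chernClassR_of_rank_eq_zero _ h0 hi.ne', E.chernClassR_of_rank_eq_zero _ h0 hi.ne', map_zero]
  · have hfam : IsChernFamily S E.projMap (E.xClass S hE) E.rank
        (fun i ↦ singularCohomology.ringChange φ B (2 * i) (E.chernClassR R i)) := by
      rw [E.xClass_ringChange φ hE]
      exact (E.isChernFamily_chernClassR R hE).ringChange φ
    exact (congrFun (E.eq_chernClassR_of_isChernFamily S hE hfam) i).symm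

end ComplexVectorBundle

/-- **`φ_* cᵢ(E) = cᵢ(E)_S`** for the tree's integral Chern classes `chernClassZ` and any ring
homomorphism `φ : ℤ → S` (the unique one). [cite: HusemollerFibreBundles1994, Ch. 20 §4] -/
theorem chernClassZ_ringChange {B : Type} [TopologicalSpace B] [T2Space B] [ParacompactSpace B]
    (φ : ℤ →+* S) (E : ComplexVectorBundle.{0, 0} B) (i : ℕ) :
    singularCohomology.ringChange φ B (2 * i) (chernClassZ E i) = E.chernClassR S i := by
  rw [chernClassZ_eq, E.chernClassR_ringChange φ]

/-- **The tree's Chern classes "with coefficients in `R`" are Grothendieck's classes over `R`**: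
`theChernClassTheory.chernClassIn R E i = cᵢ(E)_R` over a paracompact Hausdorff base (Husemoller
Ch. 20 §4: the image of `cᵢ(E) ∈ H²ⁱ(B; ℤ)` in `H²ⁱ(B; R)` is the class of Def. 2.6 formed over `R`).
[cite: HusemollerFibreBundles1994, Ch. 20 §4] -/
theorem theChernClassTheory_chernClassIn {B : Type} [TopologicalSpace B] [T2Space B] [ParacompactSpace B]
    (R : Type) [CommRing R] (E : ComplexVectorBundle.{0, 0} B) (i : ℕ) :
    theChernClassTheory.chernClassIn R E i = E.chernClassR R i :=
  chernClassZ_ringChange (Int.castRingHom R) E i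

end Literature.AlgebraicTopology.CharacteristicClasses
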